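import Literature.Analysis.FluidPDE.AdaptedBackwardKernel
import Literature.Analysis.FluidPDE.LerayHopf
import Literature.Analysis.FluidPDE.SuitableWeak
import Literature.Analysis.FluidPDE.NSWave0
import Literature.Analysis.FluidPDE.VectorCalculus
import Literature.Analysis.FluidPDE.NSCriticalClosureBesovKatoClass
import Literature.Analysis.FluidPDE.NSCriticalClosureBesovBounded
import Literature.Analysis.FluidPDE.TaoLocalisationHolds
import Literature.Analysis.FluidPDE.MildL3SmoothOfKNSS
import Literature.Analysis.FluidPDE.KNSSLocalSmoothingHolds
import Literature.Analysis.FluidPDE.NSBoundedMildSmoothing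
import Literature.Analysis.FluidPDE.KNSSMildRegularity
import Literature.Analysis.FluidPDE.KNSSTypeII
import Literature.Analysis.FluidPDE.ElgindiBlowup
import Literature.Analysis.FluidPDE.VorticityCalculus

/-! # Upper pinching of the adapted enstrophy — crux stmt-NavierStokesRegularity-10493
(`AdaptedFrequency.AdaptedFrequencyConverges`), line tauberian-omega-limit, stub stub_pinchingUpper

For a classical solution `(u, p)` of the unforced Navier–Stokes system on `ℝ³ × [0, T)` which is
Leray–Hopf from its rapidly decaying datum and blows up at most at the Type-I rate
`‖u(t)‖_∞ ≤ C/√(T − t)`, and for every flow-adapted backward kernel `G` on `[t₀, T)` (positive,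
unit mass), the adapted enstrophy `H(t) = ∫ ‖curl u(t)‖² G(t)` satisfies the UPPER PINCHING
`(T − t)² H(t) ≤ C₁` on a left neighbourhood `[t₁, T)` of `T` (`stub_pinchingUpper`).

Outline (everything rests on theorems of the tree; no named fact is assumed):
1. `pinchingUpper_ae_eq_oseen` — the BRIDGE: `u` is a Kato `C_t L³` mild solution
   (`isKatoSolutionOn_of_classical`), bounded on closed sub-slabs (Tao 2013, Cor. 11.1:
   `exists_forall_norm_le_of_tao2011 tao2011_hasBoundedSobolevNormsOn_holds`), hence solves the
   Oseen integral equation restarted at every positive time,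
   `u(t) = e^{ν(t−s)Δ}u(s) − B^ν_s(u,u)(t)` (`ae_eq_heatExtension_sub_oseenDuhamel_of_mild_L3`,
   Lemarié-Rieusset 2016, Thm. 6.1 / Prop. 6.5).
2. `pinchingUpper_window_iteratedFDeriv_le` — KNSS 2009, Prop. 4.1 in its quantitative local
   form (L) (`knss2009_local_smoothing_holds`, general viscosity) with uniqueness of bounded
   solutions (`exists_local_smooth_representative`): on a window from `s'` where `‖u‖ ≤ M`,
   `(ν(t − s'))^{k/2} ‖∇ᵏu(t, x)‖ ≤ C(k) M` for `t − s' < ε(k)ν/M²`.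
3. `pinchingUpper_iteratedFDeriv_bound` — with the Type-I rate on the whole interval
   (`IsTypeIBlowup.exists_sqrt_mul_norm_le`), windows of length `κ(T − t)` give the
   scale-invariant bounds `‖∇ᵏu(t, x)‖ ≤ K(k) (T − t)^{−(k+1)/2}` on `[T/2, T)` for EVERY `k`
   (general-`k` bridge lemma, reusable by the neighbouring stub `stub_kernelCalculus`);
   `pinchingUpper_fderiv_bound` is `k = 1`: `‖∇u(t, x)‖ ≤ K/(T − t)`.
4. `‖curl u‖ ≤ 4‖∇u‖` (`norm_curl_le_four_mul`) and unit mass of `G`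
   (`pinchingUpper_adaptedEnstrophy_le_of_bound`) give `(T − t)² H(t) ≤ 16 K²`.

Sources: Koch–Nadirashvili–Seregin–Šverák, Acta Math. 203 (2009), Prop. 4.1 with (4.6);
Lemarié-Rieusset 2016, Thm. 6.1, Prop. 6.5, Thm. 15.1; Tao, Anal. PDE 6 (2013), Cor. 11.1. -/

noncomputable section

open scoped Topology InnerProductSpace RealInnerProductSpace
open Literature.Analysis.FluidPDE Set Filter MeasureTheory
open Literature.Analysis.UnboundedOperators (heatExtension)

namespace Summit.NavierStokesRegularity.NavierStokesRegularity.Theorems.AdaptedFrequencyConverges.TauberianOmegaLimit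

/-! ### 1. The bridge: the Oseen integral equation restarted at positive times -/

/-- **Bridge.** A classical solution on `ℝ³ × [0, T)`, Leray–Hopf from its rapidly decaying
datum, solves the Oseen integral equation restarted at every positive time: for `0 < s < t < T`,
`u(t) = e^{ν(t−s)Δ}u(s) − B^ν_s(u, u)(t)` a.e. (it is a Kato `C_t L³` mild solution, bounded on
closed sub-slabs by Tao 2013, Cor. 11.1; Lemarié-Rieusset 2016, Thm. 6.1 / Prop. 6.5). -/
theorem pinchingUpper_ae_eq_oseen {ν T : ℝ}
    {u : ℝ → EuclideanSpace ℝ (Fin 3) → EuclideanSpace ℝ (Fin 3)}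
    {p : ℝ → EuclideanSpace ℝ (Fin 3) → ℝ} (hν : 0 < ν) (hT : 0 < T)
    (hcl : IsClassicalNSSolutionOn (Ico 0 T) ν 0 u p) (hLH : IsLerayHopfOn T ν 0 (u 0) u)
    (hdec : HasRapidSpatialDecay (u 0)) ⦃s t : ℝ⦄ (hs : 0 < s) (hst : s < t) (htT : t < T) :
    u t =ᵐ[volume] fun x => heatExtension (u s) (ν * (t - s)) x - oseenDuhamel ν s u u t x := by
  have hK := isKatoSolutionOn_of_classical hν hT hcl hLH hdec
  have hbdd := exists_forall_norm_le_of_tao2011 tao2011_hasBoundedSobolevNormsOn_holds hν hcl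
    hLH hdec
  refine ae_eq_heatExtension_sub_oseenDuhamel_of_mild_L3 hν hT (hK.memLp_initial hT) hK.mild
    hK.continuousInLpOn hK.aestronglyMeasurable ?_ hs hst htT
  intro s' T₁ hs' hs'T₁ hT₁T
  obtain ⟨M, hM⟩ := hbdd T₁ ⟨hs'.trans_le hs'T₁, hT₁T⟩
  refine ⟨max M 1, by positivity, fun τ hτ => eLpNorm_top_le_of_bound fun x => ?_⟩
  exact (hM τ ⟨hs'.le.trans hτ.1, hτ.2⟩ x).trans (le_max_left _ _)

/-! ### 2. KNSS 2009, Prop. 4.1 on a window of boundedness -/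

/-- **KNSS 2009, Prop. 4.1 (quantitative, order `k`) for the classical Leray–Hopf solution on a
window of boundedness.** There are `ε(k) > 0`, `C(k) ≥ 0` such that: if `‖u‖ ≤ M` on
`[s', T₁] × ℝ³`, `0 < s' < T₁ < T`, `0 < M`, then for `s' < t < min (s' + ε ν / M², T₁)` and all
`x`, `(ν (t − s'))^{k/2} ‖∇ᵏu(t, x)‖ ≤ C M` (the smooth local Oseen solution from `u(s')` of
`knss2009_local_smoothing_holds` coincides with `u`, by uniqueness of bounded solutions and
continuity). -/
theorem pinchingUpper_window_iteratedFDeriv_le {ν T : ℝ}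
    {u : ℝ → EuclideanSpace ℝ (Fin 3) → EuclideanSpace ℝ (Fin 3)}
    {p : ℝ → EuclideanSpace ℝ (Fin 3) → ℝ} (hν : 0 < ν) (hT : 0 < T)
    (hcl : IsClassicalNSSolutionOn (Ico 0 T) ν 0 u p) (hLH : IsLerayHopfOn T ν 0 (u 0) u)
    (hdec : HasRapidSpatialDecay (u 0)) (k : ℕ) :
    ∃ ε : ℝ, 0 < ε ∧ ∃ C : ℝ, 0 ≤ C ∧ ∀ ⦃s' T₁ M : ℝ⦄, 0 < s' → s' < T₁ → T₁ < T → 0 < M →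
      (∀ τ ∈ Icc s' T₁, ∀ y, ‖u τ y‖ ≤ M) →
      ∀ t ∈ Ioo s' (min (s' + ε * ν / M ^ 2) T₁), ∀ x,
        (ν * (t - s')) ^ ((k : ℝ) / 2) * ‖iteratedFDeriv ℝ k (u t) x‖ ≤ C * M := by
  obtain ⟨ε, hε, C, hC, hL⟩ := knss2009_local_smoothing_holds (EuclideanSpace ℝ (Fin 3)) k 0
  refine ⟨ε, hε, C, hC, fun s' T₁ M hs' hs'T₁ hT₁T hM hbd t ht x => ?_⟩
  have hs'T : s' < T := hs'T₁.trans hT₁T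
  -- the hypotheses of the uniqueness / local-representative lemma
  have hcont : ContinuousOn (Function.uncurry u) (Ico 0 T ×ˢ univ) :=
    hcl.smooth_velocity.continuousOn
  have hsub : Ioo s' T₁ ×ˢ (univ : Set (EuclideanSpace ℝ (Fin 3))) ⊆ Ico 0 T ×ˢ univ :=
    prod_mono (fun τ hτ => ⟨hs'.le.trans hτ.1.le, hτ.2.trans hT₁T⟩) Subset.rfl
  have hum : AEStronglyMeasurable (Function.uncurry u) (volume.restrict (Ioo s' T₁ ×ˢ univ)) :=
    (hcont.mono hsub).aestronglyMeasurable (measurableSet_Ioo.prod MeasurableSet.univ)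
  have ha' : AEStronglyMeasurable (u s') volume :=
    (hcl.contDiff_velocity ⟨hs'.le, hs'T⟩).continuous.aestronglyMeasurable
  have ha'M : eLpNorm (u s') ⊤ volume ≤ ENNReal.ofReal M :=
    eLpNorm_top_le_of_bound (hbd s' ⟨le_rfl, hs'T₁.le⟩)
  have huM : ∀ τ ∈ Ioo s' T₁, eLpNorm (u τ) ⊤ volume ≤ ENNReal.ofReal M := fun τ hτ =>
    eLpNorm_top_le_of_bound (hbd τ ⟨hτ.1.le, hτ.2.le⟩)
  have husol : ∀ τ ∈ Ioo s' T₁, u τ =ᵐ[volume] fun x =>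
      heatExtension (u s') (ν * (τ - s')) x - oseenDuhamel ν s' u u τ x := fun τ hτ =>
    pinchingUpper_ae_eq_oseen hν hT hcl hLH hdec hs' hτ.1 (hτ.2.trans hT₁T)
  obtain ⟨v, hvs, hae, -, -, hvbd⟩ :=
    exists_local_smooth_representative hL hν hM hC ha' ha'M hum huM husol
  have htw : t ∈ Ioo s' (s' + ε * ν / M ^ 2) := ⟨ht.1, ht.2.trans_le (min_le_left _ _)⟩
  have htT : t < T := (ht.2.trans_le (min_le_right _ _)).trans hT₁T
  -- `u t = v t` everywhere: both are continuous and they agree a.e.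
  have hvc : Continuous (v t) := by
    have h2 : Continuous fun x : EuclideanSpace ℝ (Fin 3) =>
        ((t, x) : ℝ × EuclideanSpace ℝ (Fin 3)) :=
      continuous_const.prodMk continuous_id
    exact hvs.continuousOn.comp_continuous h2 fun x => ⟨htw, mem_univ _⟩
  have huc : Continuous (u t) := (hcl.contDiff_velocity ⟨(hs'.trans ht.1).le, htT⟩).continuous
  have heq : u t = v t := (Continuous.ae_eq_iff_eq volume huc hvc).1 (hae t ht)
  have hb := hvbd t htw x
  have hfun : (fun y => iteratedDeriv 0 (fun τ => v τ y) t) = u t := by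
    funext y
    rw [iteratedDeriv_zero, heq]
  rwa [pow_zero, mul_one, hfun] at hb

/-! ### 3. The Type-I derivative bounds near the blow-up time -/

/-- **Type-I derivative bounds of every order (general-`k` bridge lemma).** For a classical
solution on `ℝ³ × [0, T)`, Leray–Hopf from its rapidly decaying datum, with the Type-I rate at
`T`, and every `k`, there is `K ≥ 0` with `‖∇ᵏu(t, x)‖ ≤ K (T − t)^{−(k+1)/2}` for all
`t ∈ [T/2, T)` and all `x` (KNSS 2009, Prop. 4.1 on the windows `(t − κ(T − t), t)`, where
`‖u‖ ≤ 2C₀/√(T − t)` by the Type-I rate on the whole interval,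
`IsTypeIBlowup.exists_sqrt_mul_norm_le`). -/
theorem pinchingUpper_iteratedFDeriv_bound {ν T : ℝ}
    {u : ℝ → EuclideanSpace ℝ (Fin 3) → EuclideanSpace ℝ (Fin 3)}
    {p : ℝ → EuclideanSpace ℝ (Fin 3) → ℝ} (hν : 0 < ν) (hT : 0 < T)
    (hcl : IsClassicalNSSolutionOn (Ico 0 T) ν 0 u p) (hLH : IsLerayHopfOn T ν 0 (u 0) u)
    (hdec : HasRapidSpatialDecay (u 0)) (hTI : IsTypeIBlowup u T) (k : ℕ) :
    ∃ K : ℝ, 0 ≤ K ∧ ∀ t ∈ Ico (T / 2) T, ∀ x,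
      ‖iteratedFDeriv ℝ k (u t) x‖ ≤ K * (T - t) ^ (-(((k : ℝ) + 1) / 2)) := by
  obtain ⟨ε, hε, C, hC, hW⟩ := pinchingUpper_window_iteratedFDeriv_le hν hT hcl hLH hdec k
  have hbdd := exists_forall_norm_le_of_tao2011 tao2011_hasBoundedSobolevNormsOn_holds hν hcl
    hLH hdec
  -- the Type-I rate on the whole interval
  have hbdd' : ∀ T' < T, ∃ M : ℝ, ∀ t ∈ Icc 0 T', ∀ x, ‖u t x‖ ≤ M := by
    intro T' hT'
    obtain ⟨M, hM⟩ := hbdd (max T' (T / 2))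
      ⟨lt_max_of_lt_right (by linarith), max_lt hT' (by linarith)⟩
    exact ⟨M, fun t ht x => hM t ⟨ht.1, ht.2.trans (le_max_left _ _)⟩ x⟩
  obtain ⟨C₀', hC₀'⟩ := hTI.exists_sqrt_mul_norm_le hbdd'
  set C₀ : ℝ := max C₀' 1 with hC₀def
  have hC₀1 : 1 ≤ C₀ := le_max_right _ _
  have hC₀ : 0 < C₀ := by positivity
  -- the window ratio `κ`
  set κ : ℝ := min (1 / 4) (ε * ν / (8 * C₀ ^ 2)) with hκdef
  have hκ : 0 < κ := by positivity
  have hκ4 : κ ≤ 1 / 4 := min_le_left _ _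
  have hκε : κ ≤ ε * ν / (8 * C₀ ^ 2) := min_le_right _ _
  have hνκ : 0 < ν * κ := mul_pos hν hκ
  refine ⟨2 * C * C₀ * (ν * κ) ^ (-((k : ℝ) / 2)), by positivity, fun t ht x => ?_⟩
  -- the window `[s', T₁]`, `s' = t − κ a`, `T₁ = t + 3a/4`, `a = T − t`
  set a : ℝ := T - t with hadef
  have ha : 0 < a := sub_pos.2 ht.2
  set s' : ℝ := t - κ * a with hs'def
  set T₁ : ℝ := t + 3 * a / 4 with hT₁def
  set M : ℝ := 2 * C₀ / Real.sqrt a with hMdef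
  have hsa : 0 < Real.sqrt a := Real.sqrt_pos.2 ha
  have hM : 0 < M := by positivity
  have hκa : κ * a ≤ a / 4 := by nlinarith
  have hs' : 0 < s' := by
    have : T / 2 ≤ t := ht.1
    rw [hs'def]; nlinarith
  have hs't : s' < t := by rw [hs'def]; nlinarith
  have htT₁ : t < T₁ := by rw [hT₁def]; linarith
  have hT₁T : T₁ < T := by rw [hT₁def, hadef]; linarith
  -- `‖u‖ ≤ M` on the window
  have hbd : ∀ τ ∈ Icc s' T₁, ∀ y, ‖u τ y‖ ≤ M := by
    intro τ hτ y
    have hτT : τ ∈ Ico 0 T := ⟨hs'.le.trans hτ.1, hτ.2.trans_lt hT₁T⟩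
    have h1 : Real.sqrt (T - τ) * ‖u τ y‖ ≤ C₀ := (hC₀' τ hτT y).trans (le_max_left _ _)
    have h2 : Real.sqrt a / 2 ≤ Real.sqrt (T - τ) := by
      have h3 : a / 4 ≤ T - τ := by rw [hadef]; rw [hT₁def] at hτ; linarith [hτ.2]
      refine (Real.le_sqrt' (by positivity)).2 ?_
      rw [div_pow, Real.sq_sqrt ha.le]
      linarith
    have h4 : Real.sqrt a / 2 * ‖u τ y‖ ≤ C₀ :=
      (mul_le_mul_of_nonneg_right h2 (norm_nonneg _)).trans h1
    rw [hMdef, show 2 * C₀ / Real.sqrt a = C₀ / (Real.sqrt a / 2) by field_simp]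
    exact (le_div_iff₀' (by positivity)).2 h4
  -- `t` lies in the short window from `s'`
  have hM2 : ε * ν / M ^ 2 = ε * ν / (4 * C₀ ^ 2) * a := by
    rw [hMdef, div_pow, Real.sq_sqrt ha.le]
    field_simp
    norm_num
  have htw : t ∈ Ioo s' (min (s' + ε * ν / M ^ 2) T₁) := by
    refine ⟨hs't, lt_min ?_ htT₁⟩
    rw [hM2, hs'def]
    have h1 : κ * a < ε * ν / (4 * C₀ ^ 2) * a := by
      refine mul_lt_mul_of_pos_right (hκε.trans_lt ?_) ha
      rw [div_lt_div_iff_of_pos_left (by positivity) (by positivity) (by positivity)]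
      nlinarith
    linarith
  have hb := hW hs' (hs't.trans htT₁) hT₁T hM hbd t htw x
  have hts : t - s' = κ * a := by rw [hs'def]; ring
  rw [hts, show ν * (κ * a) = ν * κ * a by ring] at hb
  have hX := le_mul_rpow_neg_of_rpow_mul_le (mul_pos hνκ ha) hb
  -- bookkeeping of the powers of `a`
  have hsplit : (ν * κ * a) ^ (-((k : ℝ) / 2)) =
      (ν * κ) ^ (-((k : ℝ) / 2)) * a ^ (-((k : ℝ) / 2)) :=
    Real.mul_rpow hνκ.le ha.le
  have hsqrt : (Real.sqrt a)⁻¹ = a ^ (-(1 / 2 : ℝ)) := by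
    rw [Real.sqrt_eq_rpow, Real.rpow_neg ha.le]
  have hpow : a ^ (-(1 / 2 : ℝ)) * a ^ (-((k : ℝ) / 2)) = a ^ (-(((k : ℝ) + 1) / 2)) := by
    rw [← Real.rpow_add ha]; congr 1; ring
  calc ‖iteratedFDeriv ℝ k (u t) x‖ ≤ C * M * (ν * κ * a) ^ (-((k : ℝ) / 2)) := hX
    _ = 2 * C * C₀ * (ν * κ) ^ (-((k : ℝ) / 2)) * (a ^ (-(1 / 2 : ℝ)) * a ^ (-((k : ℝ) / 2))) := by
        rw [hsplit, hMdef, div_eq_mul_inv, hsqrt]; ring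
    _ = 2 * C * C₀ * (ν * κ) ^ (-((k : ℝ) / 2)) * (T - t) ^ (-(((k : ℝ) + 1) / 2)) := by
        rw [hpow]

/-- **Type-I gradient bound** (`k = 1`): `‖∇u(t, x)‖ ≤ K/(T − t)` on `[T/2, T) × ℝ³`. -/
theorem pinchingUpper_fderiv_bound {ν T : ℝ}
    {u : ℝ → EuclideanSpace ℝ (Fin 3) → EuclideanSpace ℝ (Fin 3)}
    {p : ℝ → EuclideanSpace ℝ (Fin 3) → ℝ} (hν : 0 < ν) (hT : 0 < T)
    (hcl : IsClassicalNSSolutionOn (Ico 0 T) ν 0 u p) (hLH : IsLerayHopfOn T ν 0 (u 0) u)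
    (hdec : HasRapidSpatialDecay (u 0)) (hTI : IsTypeIBlowup u T) :
    ∃ K : ℝ, 0 ≤ K ∧ ∀ t ∈ Ico (T / 2) T, ∀ x, ‖fderiv ℝ (u t) x‖ ≤ K / (T - t) := by
  obtain ⟨K, hK, h⟩ := pinchingUpper_iteratedFDeriv_bound hν hT hcl hLH hdec hTI 1
  refine ⟨K, hK, fun t ht x => ?_⟩
  have h1 := h t ht x
  have ha : 0 < T - t := sub_pos.2 ht.2
  rwa [norm_iteratedFDeriv_one, show (-((((1 : ℕ) : ℝ) + 1) / 2)) = -1 by norm_num,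
    Real.rpow_neg_one, ← div_eq_mul_inv] at h1

/-! ### 4. Unit mass of the kernel: the adapted enstrophy under a pointwise vorticity bound -/

/-- **Unit mass.** If `‖curl u(t, x)‖² ≤ K` for all `x` and the kernel slice `G(t)` is
nonnegative, integrable, of unit mass, then `H(t) = ∫ ‖curl u(t)‖² G(t) ≤ K`. -/
theorem pinchingUpper_adaptedEnstrophy_le_of_bound
    {u : ℝ → EuclideanSpace ℝ (Fin 3) → EuclideanSpace ℝ (Fin 3)}
    {G : ℝ → EuclideanSpace ℝ (Fin 3) → ℝ} {t K : ℝ} (hGpos : ∀ x, 0 ≤ G t x)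
    (hGint : Integrable (G t)) (hG1 : ∫ x, G t x = 1) (hb : ∀ x, ‖curl (u t) x‖ ^ 2 ≤ K) :
    adaptedEnstrophy u G t ≤ K := by
  rw [adaptedEnstrophy_apply]
  calc ∫ x, ‖curl (u t) x‖ ^ 2 * G t x ≤ ∫ x, K * G t x :=
        integral_mono_of_nonneg
          (Eventually.of_forall fun x => mul_nonneg (sq_nonneg _) (hGpos x)) (hGint.const_mul K)
          (Eventually.of_forall fun x => mul_le_mul_of_nonneg_right (hb x) (hGpos x))
    _ = K := by rw [integral_const_mul, hG1, mul_one]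

/-! ### 5. The stub -/

/-- **Upper pinching** `(T − t)² H(t) ≤ C₁` near `T` for the adapted enstrophy
`H(t) = ∫ ‖curl u(t)‖² G(t)` of a Type-I classical Leray–Hopf solution against a flow-adapted
backward kernel: the Type-I gradient bound `‖∇u(t)‖_∞ ≤ K/(T − t)` on `[T/2, T)` (KNSS 2009,
Prop. 4.1 on parabolic windows), `‖curl u‖ ≤ 4‖∇u‖`, and unit mass of `G(t)` give
`(T − t)² H(t) ≤ 16 K²` on `[max t₀ (T/2), T)`. The singular-point and Gaussian-comparability
hypotheses are not used. -/
theorem stub_pinchingUpper : ∀ (ν T : ℝ) (u : ℝ → EuclideanSpace ℝ (Fin 3) → EuclideanSpace ℝ (Fin 3)) (p : ℝ → EuclideanSpace ℝ (Fin 3) → ℝ) (x₀ : EuclideanSpace ℝ (Fin 3)) (t₀ : ℝ) (G : ℝ → EuclideanSpace ℝ (Fin 3) → ℝ), 0 < ν → 0 < T → IsClassicalNSSolutionOn (Ico 0 T) ν 0 u p → IsLerayHopfOn T ν 0 (u 0) u → HasRapidSpatialDecay (u 0) → IsTypeIBlowup u T → t₀ ∈ Ico 0 T → (∀ r : ℝ,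 0 < r → eLpNorm (Function.uncurry u) ⊤ (volume.restrict (parabolicCylinder r (T, x₀))) = ⊤) → IsAdaptedBackwardKernel ν u (Ico t₀ T) T x₀ G → IsGaussianComparable G (Ico t₀ T) T x₀ → ∃ t₁ ∈ Ico t₀ T, ∃ C₁ : ℝ, ∀ t ∈ Ico t₁ T, (T - t) ^ 2 * adaptedEnstrophy u G t ≤ C₁ := by
  intro ν T u p x₀ t₀ G hν hT hcl hLH hdec hTI ht₀ _hsing hker _hcmp
  obtain ⟨K, -, hK⟩ := pinchingUpper_fderiv_bound hν hT hcl hLH hdec hTI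
  refine ⟨max t₀ (T / 2), ⟨le_max_left _ _, max_lt ht₀.2 (by linarith)⟩, 16 * K ^ 2,
    fun t ht => ?_⟩
  have ht' : t ∈ Ico (T / 2) T := ⟨(le_max_right _ _).trans ht.1, ht.2⟩
  have htS : t ∈ Ico t₀ T := ⟨(le_max_left _ _).trans ht.1, ht.2⟩
  have ha : 0 < T - t := sub_pos.2 ht.2
  have hb : ∀ x, ‖curl (u t) x‖ ^ 2 ≤ 16 * K ^ 2 / (T - t) ^ 2 := fun x => by
    have h1 : ‖curl (u t) x‖ ≤ 4 * (K / (T - t)) :=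
      (norm_curl_le_four_mul (u t) x).trans (by gcongr; exact hK t ht' x)
    calc ‖curl (u t) x‖ ^ 2 ≤ (4 * (K / (T - t))) ^ 2 := pow_le_pow_left₀ (norm_nonneg _) h1 2
      _ = 16 * K ^ 2 / (T - t) ^ 2 := by field_simp; ring
  have hH := pinchingUpper_adaptedEnstrophy_le_of_bound (fun x => (hker.pos t htS x).le)
    (hker.integrable htS) (hker.integral_eq_one t htS) hb
  calc (T - t) ^ 2 * adaptedEnstrophy u G t ≤ (T - t) ^ 2 * (16 * K ^ 2 / (T - t) ^ 2) :=
        mul_le_mul_of_nonneg_left hH (sq_nonneg _)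
    _ = 16 * K ^ 2 := by field_simp

end Summit.NavierStokesRegularity.NavierStokesRegularity.Theorems.AdaptedFrequencyConverges.TauberianOmegaLimit

end
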